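import Literature.AnabelianGeometry.SemiGraphs.CoveringGraphTempered
import Mathlib.CategoryTheory.ObjectProperty.Equivalence
import HarnessLib

/-!
# Proposition 3.6 (v): `B^temp(G_S) ≌ B^temp(G)_S`, from `UniformSplitting`

Mochizuki, *Semi-graphs of anabelioids*, Publ. RIMS **42** (2006) [cite: MochizukiSemiAnbd2006,
Prop 3.6(v) p.39]. Assembly of the named fact `EtaleOfTemperedCovering` (`TemperedReconstruction`)
from the named fact `UniformSplitting` (ibid., the covering-construction sentence of print's proof,
p. 40): the `B^cov`-level equivalence `CovObj.coveringEquiv S : B^cov(G)_S ≌ B^cov(G_S)`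
(`CoveringGraphEquiv`) matches the tempered objects on both sides (`CoveringGraphTempered`: one
direction unconditional, the other under `UniformSplitting`), hence restricts to
`B^temp(G_S) ≌ B^temp(G)_S`:

* `CovObj.overBTempEquiv` — `B^temp(G)_S` as the full subcategory of `B^cov(G)_S` on the objects with
  tempered source;
* `CovObj.etaleEquiv` — the equivalence `B^temp(G_S) ≌ B^temp(G)_S`;
* `etaleOfTemperedCovering_of_uniformSplitting : UniformSplitting → EtaleOfTemperedCovering`.
-/

noncomputable section

open CategoryTheory Topology

namespace Literature.AnabelianGeometry.SemiGraphs

universe u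

namespace ProfiniteSemiGraph

namespace CovObj

variable {𝒢 : ProfiniteSemiGraph.{u}}

/-- Temperedness of objects of `B^cov(G)` is closed under isomorphisms.
[cite: MochizukiSemiAnbd2006, Def 3.5(ii) p.37] -/
instance isClosedUnderIsomorphisms_isTempered :
    ObjectProperty.IsClosedUnderIsomorphisms (fun T : CovObj 𝒢 => T.IsTempered) :=
  ⟨fun e h => isTempered_of_iso e.symm h⟩

variable (S : CovObj 𝒢)

/-- The objects of `B^cov(G)_S` with tempered source. [cite: MochizukiSemiAnbd2006, Prop 3.6(v) p.39] -/
abbrev temperedOver : ObjectProperty (Over S) := fun T => T.left.IsTempered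

/-- `B^temp(G)_S ⥤ {T → S | T tempered}`: forget that the structure map is a morphism of the full
subcategory. [cite: MochizukiSemiAnbd2006, Prop 3.6(v) p.39] -/
def overBTempFunctor (hS : S.IsTempered) :
    Over (⟨S, hS⟩ : BTempCat 𝒢) ⥤ (S.temperedOver).FullSubcategory where
  obj U := ⟨Over.mk U.hom.hom, U.left.property⟩
  map f := ObjectProperty.homMk (Over.homMk f.left.hom
    (congrArg InducedCategory.Hom.hom (Over.w f)))
  map_id U := by
    apply ObjectProperty.hom_ext
    exact Over.OverMorphism.ext rfl
  map_comp f g := by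
    apply ObjectProperty.hom_ext
    exact Over.OverMorphism.ext rfl

/-- `{T → S | T tempered} ⥤ B^temp(G)_S`. [cite: MochizukiSemiAnbd2006, Prop 3.6(v) p.39] -/
def overBTempInverse (hS : S.IsTempered) :
    (S.temperedOver).FullSubcategory ⥤ Over (⟨S, hS⟩ : BTempCat 𝒢) where
  obj V := Over.mk (Y := (⟨V.obj.left, V.property⟩ : BTempCat 𝒢)) (ObjectProperty.homMk V.obj.hom)
  map g := Over.homMk (ObjectProperty.homMk g.hom.left)
    (ObjectProperty.hom_ext _ (Over.w g.hom))
  map_id _ := Over.OverMorphism.ext rfl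
  map_comp _ _ := Over.OverMorphism.ext rfl

/-- **`B^temp(G)_S ≌ {T → S | T tempered}`** (bookkeeping: the slice of the full subcategory is the
full subcategory of the slice). [cite: MochizukiSemiAnbd2006, Prop 3.6(v) p.39] -/
def overBTempEquiv (hS : S.IsTempered) :
    Over (⟨S, hS⟩ : BTempCat 𝒢) ≌ (S.temperedOver).FullSubcategory where
  functor := S.overBTempFunctor hS
  inverse := S.overBTempInverse hS
  unitIso := NatIso.ofComponents (fun _ => Iso.refl _) (fun f => by
    simp only [Functor.id_map, Functor.comp_map, Iso.refl_hom]
    rfl)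
  counitIso := NatIso.ofComponents (fun _ => Iso.refl _) (fun f => by
    simp only [Functor.id_map, Functor.comp_map, Iso.refl_hom]
    rfl)
  functor_unitIso_comp U := by
    simp only [NatIso.ofComponents_hom_app, Iso.refl_hom]
    rfl

/-- Under `UniformSplitting` (and the hypotheses of Prop. 3.6 with `G` coherent, `S` tempered), an
object `T → S` has tempered source iff its image in `B^cov(G_S)` is tempered.
[cite: MochizukiSemiAnbd2006, Prop 3.6(v) p.40] -/
theorem inverseImage_isTempered_eq (hU : UniformSplitting.{u}) (h36 : 𝒢.Prop36Hypotheses)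
    (hcoh : 𝒢.IsCoherent) (hS : S.IsTempered) :
    ObjectProperty.inverseImage (fun T' : CovObj S.coveringGraph => T'.IsTempered)
        S.coveringEquiv.functor = S.temperedOver := by
  funext T
  exact propext ⟨fun h => S.isTempered_of_toCovering hU h36 hcoh hS T h,
    fun h => S.isTempered_toCovering T h⟩

/-- **The étale equivalence `B^temp(G_S) ≌ B^temp(G)_S`** of Proposition 3.6 (v), from
`UniformSplitting`: the `B^cov`-level equivalence `coveringEquiv` restricted to the tempered objects.
[cite: MochizukiSemiAnbd2006, Prop 3.6(v) p.39] -/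
def etaleEquiv (hU : UniformSplitting.{u}) (h36 : 𝒢.Prop36Hypotheses) (hcoh : 𝒢.IsCoherent)
    (hS : S.IsTempered) : BTempCat S.coveringGraph ≌ Over (⟨S, hS⟩ : BTempCat 𝒢) :=
  ((S.overBTempEquiv hS).trans
    (S.coveringEquiv.congrFullSubcategory (S.inverseImage_isTempered_eq hU h36 hcoh hS))).symm

end CovObj

/-- **Proposition 3.6 (v) from `UniformSplitting`** ([SemiAnbd] §3 p. 39–40): the covering-
construction sentence of print's proof (named fact `UniformSplitting`) implies the named fact
`EtaleOfTemperedCovering` — for `G` as in Prop. 3.6 and coherent and `S` tempered,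
`B^temp(G_S) ≌ B^temp(G)_S`. [cite: MochizukiSemiAnbd2006, Prop 3.6(v) p.39] -/
theorem etaleOfTemperedCovering_of_uniformSplitting (hU : UniformSplitting.{u}) :
    EtaleOfTemperedCovering.{u} :=
  fun _ h36 hcoh S hS => ⟨S.etaleEquiv hU h36 hcoh hS⟩

end ProfiniteSemiGraph

end Literature.AnabelianGeometry.SemiGraphs

end
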